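import Literature.Probability.Percolation.SlabRSWGluingHighProbSeg
import Literature.Probability.Percolation.SlabRSWGluingLinearOfLocated
import HarnessLib

/-!
# Newman–Tassion–Wu 2017, §3.2 — the gluing lemma with a SEGMENT target in a domain that is only
# LOCALLY a top extension of `S` (`R = [a,b]×[c,d'] ∪ Rx`, `Rx` far from `S`): the whole chain, both regimes

Topic: `Literature/Probability/Percolation`. The high-probability regime of NTW's gluing lemma in the
tree (`glue_highProb_of_gadgets_entR`, lead GEN 37) needs `C` far from `S` (Fact 1 in general
position) and a located gadget at every entry cell. The second gluing (3.29) of the proof of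
Prop. 3.9 (1) cannot be obtained from a FULL-SIDE target in that regime (the `C`-path enters `S`
through the side carrying `B`); NTW's own (3.29) uses a SEGMENT target (`Γ : L(R') → Y`,
`σ : R(R') → X`, `X`, `Y` interleaved bottom segments). This file sets up the corresponding two-domain
geometry — after a rotation: `S = [a,b] × [c,d] ⊆ R = [a,b] × [c,d']` (a pure top extension),
target `B = {b} × [y₁, y₂]` a segment of the right side of `S` well below its top-right corner,
`A ⊆ S`, `C ⊆ R` — and re-runs, from PORT DATA at a prescribed entry cell, p2's plain surgery
(`exists_surgery_noB`, the cleared box meets no cell of `B`; here the box may stick out above the row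
`d`: trunk in `box ∩ S`, branch in `box ∩ R` as in the lead's `exists_surgery_ext_at`) and the direct
gluing near `A`.

This is `SlabRSWGluingSegExt.lean` + `SlabRSWGluingSegExtB.lean` + the `Γ`-free form of
`SlabRSWGluingHighProbSeg.lean` re-run VERBATIM for the generalised datum `SegExtLSetup` (extra part `Rx` of
`R` at sup-distance `> 2ρ + 4` from `S`; every contact and every cleared box then lies in the rectangular
part, so nothing else changes). Needed for (3.65) of the proof of Theorem 3.10, where the far set `C` is the
right end of the L-shaped region `S₁` and `Γ` lives in the bottom block of its vertical arm (memo of the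
lead, gen 38, §7).

* `SegExtLSetup`, `exists_surgery_segExtL_at`, `exists_directGlue_A_segExtL_at`, `exists_surgeryB_segExtL_at`,
  `exists_gadgetAt_segExtL`, **`glue_highProb_segExtL`**, **`glue_linear_segExtL`**, `cross₂_of_segExtL`,
  **`glue0_highProb_segExtL`**, **`glue0_linear_segExtL`**.

## Sources

* C. M. Newman, V. Tassion, U. Wu, *Critical percolation and the minimal spanning tree in slabs*,
  Comm. Pure Appl. Math. 70 (2017), arXiv:1512.09107: §3.2, Theorems 3.6–3.7 and the proof of
  Theorem 3.7, steps (1)–(3), Fact 2; §3.3, proof of Proposition 3.9, (3.29) [NewmanTassionWu2017].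
-/

noncomputable section

namespace Literature.Probability.Percolation

open MeasureTheory LatticeModels SimpleGraph

namespace NTW17

variable {k : ℕ}

/-! ## The setting -/

/-- **GL with a segment target and a top extension**: `S = [a,b] × [c,d]` (at least four columns and
rows) inside `R = [a,b] × [c,d']` (`d ≤ d'`), target `B = {b} × [y₁, y₂]` with `c ≤ y₁ < y₂ ≤ d`,
`A ⊆ S`, `C ⊆ R`. [cite: NewmanTassionWu2017, §3.2 (Theorem 3.7, the sets S, R, A, B, C); §3.3 (proof of Proposition 3.9, (3.29))] -/
structure SegExtLSetup where
  /-- left column of `S` and `R` -/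
  a : ℤ
  /-- right column of `S` and `R` (the side carrying `B`) -/
  b : ℤ
  /-- bottom row of `S` and `R` -/
  c : ℤ
  /-- top row of `S` -/
  d : ℤ
  /-- top row of `R` -/
  d' : ℤ
  /-- bottom end of `B` -/
  y₁ : ℤ
  /-- top end of `B` -/
  y₂ : ℤ
  /-- the set to be reached -/
  A : Set (ℤ × ℤ)
  /-- the set to be glued -/
  C : Set (ℤ × ℤ)
  hab : a + 3 ≤ b
  hcd : c + 3 ≤ d
  hdd' : d ≤ d'
  hy₁ : c ≤ y₁
  hy : y₁ < y₂
  hy₂ : y₂ ≤ d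
  /-- the extra part of `R` (far from `S`) -/
  Rx : Set (ℤ × ℤ)
  hRxfin : Rx.Finite
  hA : A ⊆ boxR a b c d
  hC : C ⊆ boxR a b c d' ∪ Rx

namespace SegExtLSetup

variable (U : SegExtLSetup)

/-- The rectangle `S` (domain of the minimal path). [cite: NewmanTassionWu2017, §3.2 (Theorem 3.7, S)] -/
def S : Set (ℤ × ℤ) := boxR U.a U.b U.c U.d

/-- The rectangular part `[a,b] × [c,d']` of `R` (a top extension of `S`). [cite: NewmanTassionWu2017, §3.2 (Theorem 3.7, R)] -/
def Rbox : Set (ℤ × ℤ) := boxR U.a U.b U.c U.d'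

/-- The domain `R = [a,b] × [c,d'] ∪ Rx` of the glued connection. [cite: NewmanTassionWu2017, §3.2 (Theorem 3.7, R; Remark 2)] -/
def R : Set (ℤ × ℤ) := U.Rbox ∪ U.Rx

/-- The target segment `B = {b} × [y₁, y₂]`. [cite: NewmanTassionWu2017, §3.2 (Theorem 3.7, B)] -/
def B : Set (ℤ × ℤ) := {z | z.1 = U.b ∧ U.y₁ ≤ z.2 ∧ z.2 ≤ U.y₂}

/-- `S ⊆ Rbox`. [cite: NewmanTassionWu2017, §3.2 (Theorem 3.7)] -/
theorem S_subset_Rbox : U.S ⊆ U.Rbox := by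
  intro z hz
  rw [S, mem_boxR_iff] at hz
  rw [Rbox, mem_boxR_iff]
  have := U.hdd'
  omega

/-- `Rbox ⊆ R`. [cite: NewmanTassionWu2017, §3.2 (Theorem 3.7)] -/
theorem Rbox_subset_R : U.Rbox ⊆ U.R := Set.subset_union_left

/-- `S ⊆ R`. [cite: NewmanTassionWu2017, §3.2 (Theorem 3.7)] -/
theorem S_subset_R : U.S ⊆ U.R := U.S_subset_Rbox.trans U.Rbox_subset_R

/-- `R` is finite. [cite: NewmanTassionWu2017, §3.2 (Theorem 3.7)] -/
theorem R_finite : U.R.Finite := (boxR_finite _ _ _ _).union U.hRxfin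

/-- The gluing data `(S, R, A, B, C)`. [cite: NewmanTassionWu2017, §3.2 (Theorem 3.7)] -/
def Q : GlueData := ⟨U.S, U.R, U.A, U.B, U.C, U.S_subset_R, boxR_finite _ _ _ _, U.R_finite⟩

/-- The cleared box `(z + B_r) ∩ Rbox`. [cite: NewmanTassionWu2017, §3.2 (proof of Theorem 3.7, the ball B_{r+2}(z))] -/
def Dbox (z : ℤ × ℤ) (r : ℕ) : Set (ℤ × ℤ) :=
  boxR (max U.a (z.1 - r)) (min U.b (z.1 + r)) (max U.c (z.2 - r)) (min U.d' (z.2 + r))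

/-- The trunk box `(z + B_r) ∩ S`. [cite: NewmanTassionWu2017, §3.2 (proof of Theorem 3.7, the ball B_{r+1}(z) ∩ S)] -/
def DS (z : ℤ × ℤ) (r : ℕ) : Set (ℤ × ℤ) :=
  boxR (max U.a (z.1 - r)) (min U.b (z.1 + r)) (max U.c (z.2 - r)) (min U.d (z.2 + r))

/-- The trunk box minus the column `x = b`: `(z + B_r) ∩ S ∖ {x = b}`. [cite: NewmanTassionWu2017, §3.2 (proof of Theorem 3.7)] -/
def DG (z : ℤ × ℤ) (r : ℕ) : Set (ℤ × ℤ) :=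
  boxR (max U.a (z.1 - r)) (min (U.b - 1) (z.1 + r)) (max U.c (z.2 - r)) (min U.d (z.2 + r))

/-- `B` meets the box of radius `r` around `z`. [cite: NewmanTassionWu2017, §3.2 (proof of Theorem 3.7)] -/
def Bnear (z : ℤ × ℤ) (r : ℕ) : Prop := U.b ≤ z.1 + r ∧ U.y₁ ≤ z.2 + r ∧ z.2 - r ≤ U.y₂

/-- `B` meets the box of radius `r` around `z` in at least two rows. [cite: NewmanTassionWu2017, §3.2 (proof of Theorem 3.7)] -/
def Btwo (z : ℤ × ℤ) (r : ℕ) : Prop := U.b ≤ z.1 + r ∧ U.y₁ + 1 ≤ z.2 + r ∧ z.2 - r + 1 ≤ U.y₂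

/-- **The radius of the cleared box**: `ρ + 3` above the row `d`; otherwise `ρ + 2`, enlarged to
`ρ + 3` when `B` meets the box of radius `ρ + 2` in exactly one row (p2's `SegSetup.R`).
[cite: NewmanTassionWu2017, §3.2 (proof of Theorem 3.7, the radius r)] -/
def rad (ρ : ℕ) (z : ℤ × ℤ) : ℕ :=
  open scoped Classical in
  if U.d < z.2 then ρ + 3 else if U.Bnear z (ρ + 2) ∧ ¬U.Btwo z (ρ + 2) then ρ + 3 else ρ + 2

variable {U}

/-- Membership in `S`. [cite: NewmanTassionWu2017, §3.2 (Theorem 3.7, S)] -/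
theorem mem_S_iff {z : ℤ × ℤ} : z ∈ U.S ↔ U.a ≤ z.1 ∧ z.1 ≤ U.b ∧ U.c ≤ z.2 ∧ z.2 ≤ U.d :=
  mem_boxR_iff z

/-- Membership in `Rbox`. [cite: NewmanTassionWu2017, §3.2 (Theorem 3.7, R)] -/
theorem mem_Rbox_iff {z : ℤ × ℤ} : z ∈ U.Rbox ↔ U.a ≤ z.1 ∧ z.1 ≤ U.b ∧ U.c ≤ z.2 ∧ z.2 ≤ U.d' :=
  mem_boxR_iff z

/-- Membership in `R`. [cite: NewmanTassionWu2017, §3.2 (Theorem 3.7, R)] -/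
theorem mem_R_iff' {z : ℤ × ℤ} : z ∈ U.R ↔ z ∈ U.Rbox ∨ z ∈ U.Rx := Iff.rfl

/-- Membership in `B`. [cite: NewmanTassionWu2017, §3.2 (Theorem 3.7, B)] -/
theorem mem_B_iff {z : ℤ × ℤ} : z ∈ U.B ↔ z.1 = U.b ∧ U.y₁ ≤ z.2 ∧ z.2 ≤ U.y₂ := Iff.rfl

/-- `B ⊆ S`. [cite: NewmanTassionWu2017, §3.2 (Theorem 3.7, B ⊆ ∂S)] -/
theorem B_subset_S : U.B ⊆ U.S := by
  intro z hz
  rw [mem_B_iff] at hz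
  rw [mem_S_iff]
  have := U.hab; have := U.hy₁; have := U.hy₂
  omega

/-- Membership in `Dbox`. [cite: NewmanTassionWu2017, §3.2 (proof of Theorem 3.7)] -/
theorem mem_Dbox_iff {z w : ℤ × ℤ} {r : ℕ} : w ∈ U.Dbox z r ↔ w ∈ U.Rbox ∧ w ∈ sqBox z r := by
  rw [Dbox, mem_boxR_iff, mem_Rbox_iff, mem_sqBox_iff']
  simp only [max_le_iff, le_min_iff]
  omega

/-- Membership in `DS`. [cite: NewmanTassionWu2017, §3.2 (proof of Theorem 3.7)] -/
theorem mem_DS_iff {z w : ℤ × ℤ} {r : ℕ} : w ∈ U.DS z r ↔ w ∈ U.S ∧ w ∈ sqBox z r := by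
  rw [DS, mem_boxR_iff, mem_S_iff, mem_sqBox_iff']
  simp only [max_le_iff, le_min_iff]
  omega

/-- Membership in `DG`. [cite: NewmanTassionWu2017, §3.2 (proof of Theorem 3.7)] -/
theorem mem_DG_iff {z w : ℤ × ℤ} {r : ℕ} : w ∈ U.DG z r ↔ w ∈ U.S ∧ w ∈ sqBox z r ∧ w.1 ≠ U.b := by
  rw [DG, mem_boxR_iff, mem_S_iff, mem_sqBox_iff']
  simp only [max_le_iff, le_min_iff]
  omega

/-- `Dbox ⊆ R`. [cite: NewmanTassionWu2017, §3.2 (proof of Theorem 3.7)] -/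
theorem Dbox_subset_R (z : ℤ × ℤ) (r : ℕ) : U.Dbox z r ⊆ U.R := fun _ h => U.Rbox_subset_R (mem_Dbox_iff.1 h).1

/-- `Dbox ⊆ z + B_r`. [cite: NewmanTassionWu2017, §3.2 (proof of Theorem 3.7)] -/
theorem Dbox_subset_sqBox (z : ℤ × ℤ) (r : ℕ) : U.Dbox z r ⊆ sqBox z r := fun _ h => (mem_Dbox_iff.1 h).2

/-- `DS ⊆ Dbox`. [cite: NewmanTassionWu2017, §3.2 (proof of Theorem 3.7)] -/
theorem DS_subset_Dbox (z : ℤ × ℤ) (r : ℕ) : U.DS z r ⊆ U.Dbox z r := fun _ h =>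
  mem_Dbox_iff.2 ⟨U.S_subset_Rbox (mem_DS_iff.1 h).1, (mem_DS_iff.1 h).2⟩

/-- `DS ⊆ S`. [cite: NewmanTassionWu2017, §3.2 (proof of Theorem 3.7)] -/
theorem DS_subset_S (z : ℤ × ℤ) (r : ℕ) : U.DS z r ⊆ U.S := fun _ h => (mem_DS_iff.1 h).1

/-- `DG ⊆ DS`. [cite: NewmanTassionWu2017, §3.2 (proof of Theorem 3.7)] -/
theorem DG_subset_DS (z : ℤ × ℤ) (r : ℕ) : U.DG z r ⊆ U.DS z r := fun _ h =>
  mem_DS_iff.2 ⟨(mem_DG_iff.1 h).1, (mem_DG_iff.1 h).2.1⟩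

/-- `DG` avoids `B`. [cite: NewmanTassionWu2017, §3.2 (proof of Theorem 3.7)] -/
theorem DG_disjoint_B {z w : ℤ × ℤ} {r : ℕ} (h : w ∈ U.DG z r) : w ∉ U.B := fun hB =>
  (mem_DG_iff.1 h).2.2 hB.1

/-- A cell of `B` in the box of radius `r` around `z` witnesses `Bnear`.
[cite: NewmanTassionWu2017, §3.2 (proof of Theorem 3.7)] -/
theorem bnear_of_mem {z w : ℤ × ℤ} {r : ℕ} (hw : w ∈ U.B) (hwz : w ∈ sqBox z r) : U.Bnear z r := by
  rw [mem_B_iff] at hw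
  rw [mem_sqBox_iff'] at hwz
  exact ⟨by omega, by omega, by omega⟩

/-- The radius is `ρ + 2` or `ρ + 3`. [cite: NewmanTassionWu2017, §3.2 (proof of Theorem 3.7)] -/
theorem rad_bounds (ρ : ℕ) (z : ℤ × ℤ) : ρ + 2 ≤ U.rad ρ z ∧ U.rad ρ z ≤ ρ + 3 := by
  unfold rad; split_ifs <;> omega

/-- Above the row `d` the radius is `ρ + 3`. [cite: NewmanTassionWu2017, §3.2 (proof of Theorem 3.7)] -/
theorem rad_eq_of_lt {ρ : ℕ} {z : ℤ × ℤ} (h : U.d < z.2) : U.rad ρ z = ρ + 3 := by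
  unfold rad; rw [if_pos h]

/-- **If `B` meets the cleared box, it meets it in at least two rows** (for centres not above the row
`d`). [cite: NewmanTassionWu2017, §3.2 (proof of Theorem 3.7)] -/
theorem btwo_of_bnear {ρ : ℕ} {z : ℤ × ℤ} (hz : z.2 ≤ U.d) (h : U.Bnear z (U.rad ρ z)) :
    U.Btwo z (U.rad ρ z) := by
  classical
  have hy := U.hy
  unfold rad at h ⊢
  rw [if_neg (not_lt.2 hz)] at h ⊢
  by_cases hc : U.Bnear z (ρ + 2) ∧ ¬U.Btwo z (ρ + 2)
  · rw [if_pos hc] at h ⊢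
    obtain ⟨⟨h1, h2, h2'⟩, h3⟩ := hc
    simp only [Btwo, Bnear, not_and, not_le] at h3 h ⊢
    push_cast at h1 h2 h2' h3 h ⊢
    omega
  · rw [if_neg hc] at h ⊢
    rw [not_and_or, not_not] at hc
    rcases hc with hc | hc
    · exact absurd h hc
    · exact hc

/-- `Q.S = S`. [cite: NewmanTassionWu2017, §3.2 (Theorem 3.7)] -/
theorem Q_S : U.Q.S = U.S := rfl
/-- `Q.R = R`. [cite: NewmanTassionWu2017, §3.2 (Theorem 3.7)] -/
theorem Q_R : U.Q.R = U.R := rfl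
/-- `Q.A = A`. [cite: NewmanTassionWu2017, §3.2 (Theorem 3.7)] -/
theorem Q_A : U.Q.A = U.A := rfl
/-- `Q.B = B`. [cite: NewmanTassionWu2017, §3.2 (Theorem 3.7)] -/
theorem Q_B : U.Q.B = U.B := rfl
/-- `Q.C = C`. [cite: NewmanTassionWu2017, §3.2 (Theorem 3.7)] -/
theorem Q_C : U.Q.C = U.C := rfl

end SegExtLSetup

/-! ## Where a contact point can be -/

section ContactPoint

variable {U : SegExtLSetup} {ω : BondConfig (slab 3 k)} {ρ : ℕ}

/-- A point of `R` within `ρ + 4` of a point within `ρ` of `Γ̄` lies in `Rbox` when `Rx` is at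
sup-distance `> 2ρ + 4` from `S`. [cite: NewmanTassionWu2017, §3.2 (proof of Theorem 3.7, step (1)); Remark 2] -/
theorem SegExtLSetup.mem_Rbox_of_near (hA : ω ∈ U.Q.evAB k)
    (hRx : ∀ w ∈ U.Rx, ∀ s ∈ U.S, w ∉ sqBox s (2 * ρ + 4)) {z w : ℤ × ℤ}
    (hnear : Near k (U.Q.γ k ω) ρ z) (hwR : w ∈ U.R) (hwz : w ∈ sqBox z (ρ + 4)) : w ∈ U.Rbox := by
  rcases SegExtLSetup.mem_R_iff'.1 hwR with h | h
  · exact h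
  · exfalso
    obtain ⟨hγO, -⟩ := U.Q.γ_spec hA
    obtain ⟨g, hg, hz⟩ := hnear
    have hgS : planar k g ∈ U.S := hγO.subset g hg
    have : w ∈ sqBox (planar k g) (ρ + (ρ + 4)) := mem_sqBox_add hz hwz
    exact hRx w h (planar k g) hgS (by rwa [show 2 * ρ + 4 = ρ + (ρ + 4) by ring])

/-- A point of `Rbox` within `ρ` of a vertex of `Γ ⊆ S̄` satisfies `a ≤ z.1 ≤ b`, `c ≤ z.2 ≤ d + ρ`.
[cite: NewmanTassionWu2017, §3.2 (proof of Theorem 3.7, step (1))] -/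
theorem SegExtLSetup.contact_bounds (hA : ω ∈ U.Q.evAB k) {z : ℤ × ℤ} (hzR : z ∈ U.Rbox)
    (hnear : Near k (U.Q.γ k ω) ρ z) :
    U.a ≤ z.1 ∧ z.1 ≤ U.b ∧ U.c ≤ z.2 ∧ z.2 ≤ U.d + ρ := by
  obtain ⟨hγO, -⟩ := U.Q.γ_spec hA
  obtain ⟨g, hg, hz⟩ := hnear
  have hgS : planar k g ∈ U.S := hγO.subset g hg
  rw [SegExtLSetup.mem_S_iff] at hgS
  rw [SegExtLSetup.mem_Rbox_iff] at hzR
  rw [mem_sqBox_iff'] at hz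
  omega

end ContactPoint

/-! ## The plain surgery from port data: the cleared box meets no cell of `B` -/

section Plain

variable {U : SegExtLSetup} {ω : BondConfig (slab 3 k)} {ρ : ℕ}

/-- **The plain surgery at a prescribed entry cell, from port data** (segment target, top
extension): given `v ∈ R̄` within `ρ` of `Γ̄`, a lattice neighbour `u` of `v`, an `ω`-open
self-avoiding path from `c₀ ∈ C̄` to `u` inside `R̄` off the `ρ`-neighbourhood of `Γ̄`, no cell of `A`
or `C` within `ρ + 3` of `z = planar v`, and the cleared box `(z + B_{rad}) ∩ R` meeting no cell of
`B`, there is a surgery whose cleared set is inside `z + B_{ρ+3}` (trunk in the box `∩ S`, branch in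
the box `∩ R`). [cite: NewmanTassionWu2017, §3.2 (proof of Theorem 3.7, steps (1)–(3); Fact 2, ω^{(z)} for z ∈ U(ω))] -/
theorem exists_surgery_segExtL_at (hk : 1 ≤ k) (hρ : 2 ≤ ρ) (hω : ω ⊆ (slabGraph 3 k).edgeSet)
    (hX : ω ∈ U.Q.evX k) {c₀ u v : slab 3 k} {L : List (slab 3 k)} (hc₀ : c₀ ∈ slabLift k U.C)
    (hL : IsOSAP k ω (slabLift k U.R ∩ {x | ¬Near k (U.Q.γ k ω) ρ (planar k x)}) {c₀} {u} L)
    (huv : (slabGraph 3 k).Adj u v) (hvR : v ∈ slabLift k U.R)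
    (hnear : Near k (U.Q.γ k ω) ρ (planar k v))
    (hnA : ∀ a' ∈ U.A, a' ∉ sqBox (planar k v) (ρ + 3))
    (hnC : ∀ c' ∈ U.C, c' ∉ sqBox (planar k v) (ρ + 3))
    (hRx : ∀ w ∈ U.Rx, ∀ s ∈ U.S, w ∉ sqBox s (2 * ρ + 4))
    (hnB : ¬U.Bnear (planar k v) (U.rad ρ (planar k v))) :
    ∃ sx : U.Q.Surgery k ω, sx.D ⊆ sqBox (planar k v) (ρ + 3) := by
  have hA : ω ∈ U.Q.evAB k := hX.1
  obtain ⟨hγO, -⟩ := U.Q.γ_spec hA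
  set z := planar k v with hzdef
  obtain ⟨hR1, hR2⟩ := SegExtLSetup.rad_bounds (U := U) ρ z
  set r : ℕ := U.rad ρ z with hrdef
  set D := U.Dbox z r with hDdef
  set K := U.DS z r with hKdef
  have toRbox : ∀ w, w ∈ U.R → w ∈ sqBox z (ρ + 4) → w ∈ U.Rbox := fun w hw hwz =>
    SegExtLSetup.mem_Rbox_of_near hA hRx hnear hw hwz
  have hzR : z ∈ U.Rbox := toRbox z hvR (mem_sqBox_self _ _)
  obtain ⟨hz1, hz2, hz3, hz4⟩ := SegExtLSetup.contact_bounds hA hzR hnear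
  have hzR' := hzR
  rw [SegExtLSetup.mem_Rbox_iff] at hzR'
  have hab := U.hab; have hcd := U.hcd; have hdd' := U.hdd'
  have hDz : D ⊆ sqBox z (ρ + 3) := (SegExtLSetup.Dbox_subset_sqBox _ _).trans (sqBox_mono _ hR2)
  have hzD : z ∈ D := SegExtLSetup.mem_Dbox_iff.2 ⟨hzR, mem_sqBox_self _ _⟩
  have hc₀D : planar k c₀ ∉ D := fun h => hnC _ hc₀ (hDz h)
  have hDA : ∀ w ∈ D, w ∉ U.Q.A := fun w hw hwA => hnA w hwA (hDz hw)
  have hDB : ∀ w ∈ D, w ∉ U.Q.B := fun w hw hwB =>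
    hnB (SegExtLSetup.bnear_of_mem hwB (SegExtLSetup.Dbox_subset_sqBox _ _ hw))
  have hKD : K ⊆ D := SegExtLSetup.DS_subset_Dbox _ _
  -- the rows of the trunk box: at least four
  have hrows : max U.c (z.2 - (r : ℕ)) + 3 ≤ min U.d (z.2 + (r : ℕ)) := by
    by_cases hzd : U.d < z.2
    · have hr : r = ρ + 3 := SegExtLSetup.rad_eq_of_lt hzd
      simp only [max_add, le_min_iff, max_le_iff]
      rw [hr]; push_cast; omega
    · simp only [max_add, le_min_iff, max_le_iff]
      omega
  -- the port: the first entry of the far path into `D̄` (`u`, its last vertex, lies over `D`)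
  have huL : u ∈ L := by
    have := hL.last_mem hL.ne_nil
    rw [Set.mem_singleton_iff] at this
    rw [← this]; exact List.getLast_mem _
  have huD : planar k u ∈ D := by
    have hu1 : planar k u ∈ sqBox z 1 := planar_mem_sqBox_one_of_adj huv.symm
    refine SegExtLSetup.mem_Dbox_iff.2 ⟨toRbox _ (hL.subset u huL).1 (sqBox_mono _ (by omega) hu1),
      sqBox_mono _ (by omega : 1 ≤ r) hu1⟩
  have hheadL : L.head hL.ne_nil = c₀ := by
    have := hL.head_mem hL.ne_nil
    rwa [Set.mem_singleton_iff] at this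
  have hheadD : planar k (L.head hL.ne_nil) ∉ D := by rw [hheadL]; exact hc₀D
  obtain ⟨m, w', rest, hm, hLeq, hmD, hw'D, hedge, -, hmhead, hconn, -⟩ :=
    exists_entry (R := U.R) hL.chain hL.nodup (fun x hx => (hL.subset x hx).1) hL.ne_nil hheadD
      ⟨u, huL, huD⟩
  rw [hheadL] at hconn
  set q₁ := m.getLast hm with hq₁
  have hadj : (slabGraph 3 k).Adj w' q₁ := ((SimpleGraph.mem_edgeSet _).1 (hω hedge)).symm
  have hq₁D : planar k q₁ ∉ D := hmD _ (List.getLast_mem hm)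
  have hσ : ω ∈ openConnIn (slabLift k (U.Q.R \ D)) q₁ c₀ := openConnIn_reverse hconn
  have hw'L : w' ∈ L := by rw [hLeq]; simp
  have hw'far : ¬Near k (U.Q.γ k ω) ρ (planar k w') := (hL.subset w' hw'L).2
  -- two vertices of `γ` over `D`: `g₀` and its predecessor
  obtain ⟨g₀, hg₀, hz⟩ := hnear
  have hg₀z : planar k g₀ ∈ sqBox z ρ := GlueGeom.mem_sqBox_comm hz
  have hg₀h := ne_head_of_far_A (Q := U.Q) hA hz (by omega : ρ ≤ ρ + 3) hnA
  obtain ⟨g₁, hg₁γ, hadj₀, hg₁ne, -⟩ := exists_pred hω hA hg₀ hg₀h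
  have hg₀D : planar k g₀ ∈ D :=
    SegExtLSetup.mem_Dbox_iff.2 ⟨U.S_subset_Rbox (hγO.subset g₀ hg₀), sqBox_mono _ (by omega) hg₀z⟩
  have hg₁D : planar k g₁ ∈ D := by
    refine SegExtLSetup.mem_Dbox_iff.2 ⟨U.S_subset_Rbox (hγO.subset g₁ hg₁γ),
      sqBox_mono _ (by omega : ρ + 1 ≤ r) ?_⟩
    exact mem_sqBox_add hg₀z (planar_mem_sqBox_one_of_adj hadj₀.symm)
  have htwo : ∃ x ∈ U.Q.γ k ω, ∃ y ∈ U.Q.γ k ω, x ≠ y ∧ planar k x ∈ D ∧ planar k y ∈ D :=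
    ⟨g₁, hg₁γ, g₀, hg₀, hg₁ne, hg₁D, hg₀D⟩
  -- a vertex of `γ` over `D` lies over the trunk box
  have hγK : ∀ x ∈ U.Q.γ k ω, planar k x ∈ D → planar k x ∈ K := fun x hx hxD =>
    SegExtLSetup.mem_DS_iff.2 ⟨hγO.subset x hx, SegExtLSetup.Dbox_subset_sqBox _ _ hxD⟩
  -- routing: trunk in `K`, branch in `D`
  have hroute : ∀ E₁ E₂ : slab 3 k, E₁ ∈ U.Q.γ k ω → E₂ ∈ U.Q.γ k ω → E₁ ≠ E₂ →
      planar k E₁ ∈ D → planar k E₂ ∈ D → ∃ Lr Br c, RouteSpec k K D E₁ E₂ w' Lr Br c := by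
    intro E₁ E₂ hE₁ hE₂ hne hE₁D hE₂D
    have h1 : ¬Near k (U.Q.γ k ω) 0 (planar k w') := fun hn => hw'far (hn.mono (by omega))
    exact exists_route (xL := max U.a (z.1 - (r : ℕ)))
      (xR' := min U.b (z.1 + (r : ℕ))) (xR := min U.b (z.1 + (r : ℕ)))
      (rB := max U.c (z.2 - (r : ℕ))) (rP := min U.d (z.2 + (r : ℕ))) (rT := min U.d' (z.2 + (r : ℕ)))
      hk (by omega) le_rfl hrows (by omega) (hγK E₁ hE₁ hE₁D) (hγK E₂ hE₂ hE₂D)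
      hw'D hne (ne_planar_of_not_near h1 hE₁).symm (ne_planar_of_not_near h1 hE₂).symm
  obtain ⟨sx, hsx⟩ := exists_surgery_of_route (Q := U.Q) hX (D := D) (Dt := K)
    (SegExtLSetup.Dbox_subset_R _ _) hDA hDB hKD (SegExtLSetup.DS_subset_S _ _)
    htwo hadj hq₁D hc₀ hσ hroute
  exact ⟨sx, hsx ▸ hDz⟩

end Plain

/-! ## Direct gluing near `A` from port data -/

section AtA

variable {U : SegExtLSetup} {ω : BondConfig (slab 3 k)} {ρ : ℕ}

/-- **Direct gluing near `A` at a prescribed entry cell, from port data** (segment target, top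
extension): if a cell of `A` is within `ρ + 3` of `z = planar v`, the far path from `c₀ ∈ C̄` to `u`
(a lattice neighbour of `v`) enters the box `(z + B_{ρ+3}) ∩ R`, and the `C`-cluster is glued to `Ā`
inside it. [cite: NewmanTassionWu2017, §3.2 (proof of Theorem 3.7, steps (2)–(3), near A; Fact 2, ω^{(z)})] -/
theorem exists_directGlue_A_segExtL_at (hω : ω ⊆ (slabGraph 3 k).edgeSet) (hX : ω ∈ U.Q.evX k)
    (hsep : ∀ a' ∈ U.A, ∀ c' ∈ U.C, c' ∉ sqBox a' (4 * ρ + 8))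
    {c₀ u v : slab 3 k} {L : List (slab 3 k)} (hc₀ : c₀ ∈ slabLift k U.C)
    (hL : IsOSAP k ω (slabLift k U.R ∩ {x | ¬Near k (U.Q.γ k ω) ρ (planar k x)}) {c₀} {u} L)
    (huv : (slabGraph 3 k).Adj u v) (hnear : Near k (U.Q.γ k ω) ρ (planar k v))
    (hRx : ∀ w ∈ U.Rx, ∀ s ∈ U.S, w ∉ sqBox s (2 * ρ + 4))
    (hA' : ∃ a' ∈ U.A, a' ∈ sqBox (planar k v) (ρ + 3)) :
    ∃ dg : DirectGlue k U.R U.C U.A ω, dg.D ⊆ sqBox (planar k v) (ρ + 3) := by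
  set z := planar k v with hzdef
  have toRbox : ∀ w, w ∈ U.R → w ∈ sqBox z (ρ + 4) → w ∈ U.Rbox := fun w hw hwz =>
    SegExtLSetup.mem_Rbox_of_near hX.1 hRx hnear hw hwz
  set D := U.Dbox z (ρ + 3) with hDdef
  obtain ⟨a', ha', ha'z⟩ := hA'
  have hDC : ∀ w ∈ D, w ∉ U.C := by
    intro w hw hwC
    have hwz := SegExtLSetup.Dbox_subset_sqBox _ _ hw
    have : w ∈ sqBox a' ((ρ + 3) + (ρ + 3)) := mem_sqBox_add (GlueGeom.mem_sqBox_comm ha'z) hwz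
    exact hsep a' ha' w hwC (sqBox_mono _ (by omega) this)
  have hc₀D : planar k c₀ ∉ D := fun h => hDC _ h hc₀
  have huL : u ∈ L := by
    have := hL.last_mem hL.ne_nil
    rw [Set.mem_singleton_iff] at this
    rw [← this]; exact List.getLast_mem _
  have huD : planar k u ∈ D := by
    have hu1 : planar k u ∈ sqBox z 1 := planar_mem_sqBox_one_of_adj huv.symm
    exact SegExtLSetup.mem_Dbox_iff.2 ⟨toRbox _ (hL.subset u huL).1 (sqBox_mono _ (by omega) hu1),
      sqBox_mono _ (by omega : 1 ≤ ρ + 3) hu1⟩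
  have hheadL : L.head hL.ne_nil = c₀ := by
    have := hL.head_mem hL.ne_nil
    rwa [Set.mem_singleton_iff] at this
  have hheadD : planar k (L.head hL.ne_nil) ∉ D := by rw [hheadL]; exact hc₀D
  obtain ⟨m, w', rest, hm, hLeq, hmD, hw'D, hedge, -, -, hconn, -⟩ :=
    exists_entry (R := U.R) hL.chain hL.nodup (fun x hx => (hL.subset x hx).1) hL.ne_nil hheadD
      ⟨u, huL, huD⟩
  rw [hheadL] at hconn
  have hadj : (slabGraph 3 k).Adj (m.getLast hm) w' := (SimpleGraph.mem_edgeSet _).1 (hω hedge)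
  have hw'L : w' ∈ L := by rw [hLeq]; simp
  -- `w'` is joined to `c₀ ∈ C̄` inside `R̄`: it cannot lie over `A` (else `C ⟷^R A`)
  have hw'A : planar k w' ∉ U.A := by
    intro hA'
    have hj := hL.openConnIn_of_mem hw'L
    rw [hheadL] at hj
    exact hX.2 ⟨c₀, hc₀, w', hA', openConnIn_mono (Set.inter_subset_left) _ _ hj⟩
  have ha'D : a' ∈ D := SegExtLSetup.mem_Dbox_iff.2 ⟨U.S_subset_Rbox (U.hA ha'), ha'z⟩
  obtain ⟨dg, hdg⟩ := exists_directGlue (R := U.R) (Src := U.C) (Tg := U.A)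
    (SegExtLSetup.Dbox_subset_R _ _) hDC hc₀ (hmD _ (List.getLast_mem hm)) hconn hadj hw'D hw'A ha'D ha'
  exact ⟨dg, hdg ▸ SegExtLSetup.Dbox_subset_sqBox _ _⟩

end AtA

/-! ## The `B`-near surgery from port data -/

section AtB

variable {U : SegExtLSetup} {ω : BondConfig (slab 3 k)} {ρ : ℕ}

/-- **The `B`-near surgery at a prescribed entry cell, from port data** (segment target `B` at least
`2ρ + 6` below the top row of `S`): given `vnear ∈ R̄` within `ρ` of `Γ̄`, a lattice neighbour `wfar`,
an `ω`-open self-avoiding path from `c₀ ∈ C̄` to `wfar` inside `R̄` off the `ρ`-neighbourhood of `Γ̄`,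
no cell of `A` or `C` within `ρ + 3` of `z = planar vnear`, and the cleared box `(z + B_{rad}) ∩ R`
meeting `B`: a surgery ending in `B̄` whose cleared set is inside `z + B_{ρ+3}`.
[cite: NewmanTassionWu2017, §3.2 (proof of Theorem 3.7, steps (1)–(3), "v = v′ = z"; Fact 2, ω^{(z)})] -/
theorem exists_surgeryB_segExtL_at (hk : 1 ≤ k) (hρ : 2 ≤ ρ) (hω : ω ⊆ (slabGraph 3 k).edgeSet)
    (hX : ω ∈ U.Q.evX k) (hBtop : U.y₂ + 2 * ρ + 6 ≤ U.d)
    {c₀ wfar vnear : slab 3 k} {Lfar : List (slab 3 k)} (hc₀ : c₀ ∈ slabLift k U.C)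
    (hLfar : IsOSAP k ω (slabLift k U.R ∩ {x | ¬Near k (U.Q.γ k ω) ρ (planar k x)}) {c₀} {wfar} Lfar)
    (hwv : (slabGraph 3 k).Adj wfar vnear) (hvR : vnear ∈ slabLift k U.R)
    (hnear : Near k (U.Q.γ k ω) ρ (planar k vnear))
    (hnA : ∀ a' ∈ U.A, a' ∉ sqBox (planar k vnear) (ρ + 3))
    (hnC : ∀ c' ∈ U.C, c' ∉ sqBox (planar k vnear) (ρ + 3))
    (hRx : ∀ w ∈ U.Rx, ∀ s ∈ U.S, w ∉ sqBox s (2 * ρ + 4))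
    (hB : U.Bnear (planar k vnear) (U.rad ρ (planar k vnear))) :
    ∃ sb : U.Q.SurgeryB k ω, sb.D ⊆ sqBox (planar k vnear) (ρ + 3) := by
  have hA : ω ∈ U.Q.evAB k := hX.1
  obtain ⟨hγO, -⟩ := U.Q.γ_spec hA
  set z := planar k vnear with hzdef
  obtain ⟨hR1, hR2⟩ := SegExtLSetup.rad_bounds (U := U) ρ z
  set R := U.rad ρ z with hRdef
  set D := U.Dbox z R with hDdef
  set RP := U.DG z R with hRPdef
  have toRbox : ∀ w, w ∈ U.R → w ∈ sqBox z (ρ + 4) → w ∈ U.Rbox := fun w hw hwz =>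
    SegExtLSetup.mem_Rbox_of_near hA hRx hnear hw hwz
  have hzR : z ∈ U.Rbox := toRbox z hvR (mem_sqBox_self _ _)
  have hzR' := hzR
  rw [SegExtLSetup.mem_Rbox_iff] at hzR'
  have hab := U.hab; have hcd := U.hcd; have hy₁ := U.hy₁; have hy₂ := U.hy₂; have hy := U.hy
  have hdd' := U.hdd'
  -- the centre lies below the row `d` (as `B` meets the box), so `B` meets the box in two rows
  obtain ⟨hBx₀, hBy₀, hBy₀'⟩ := hB
  have hzd : z.2 ≤ U.d := by omega
  have hB2 := SegExtLSetup.btwo_of_bnear hzd ⟨hBx₀, hBy₀, hBy₀'⟩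
  obtain ⟨hBx, hBy, hBy'⟩ := hB2
  -- the box lies inside `S`
  have htop : z.2 + R ≤ U.d := by omega
  have hDz : D ⊆ sqBox z (ρ + 3) := (SegExtLSetup.Dbox_subset_sqBox _ _).trans (sqBox_mono _ hR2)
  have hRPD : RP ⊆ D := (SegExtLSetup.DG_subset_DS _ _).trans (SegExtLSetup.DS_subset_Dbox _ _)
  have hzD : z ∈ D := SegExtLSetup.mem_Dbox_iff.2 ⟨hzR, mem_sqBox_self _ _⟩
  have hc₀D : planar k c₀ ∉ D := fun h => hnC _ hc₀ (hDz h)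
  have hDA : ∀ w ∈ D, w ∉ U.Q.A := fun w hw hwA => hnA w hwA (hDz hw)
  have hDS : D ⊆ U.S := by
    intro w hw
    rw [SegExtLSetup.mem_Dbox_iff, SegExtLSetup.mem_Rbox_iff, mem_sqBox_iff'] at hw
    rw [SegExtLSetup.mem_S_iff]
    omega
  -- membership criteria
  have memRP : ∀ w : ℤ × ℤ, U.a ≤ w.1 → w.1 ≤ U.b - 1 → z.1 - R ≤ w.1 → w.1 ≤ z.1 + R →
      U.c ≤ w.2 → w.2 ≤ U.d → z.2 - R ≤ w.2 → w.2 ≤ z.2 + R → w ∈ RP := by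
    intro w h1 h2 h3 h4 h5 h6 h7 h8
    rw [SegExtLSetup.mem_DG_iff, SegExtLSetup.mem_S_iff, mem_sqBox_iff']
    exact ⟨⟨h1, by omega, h5, h6⟩, ⟨h3, h4, h7, h8⟩, by omega⟩
  have memD : ∀ w : ℤ × ℤ, w ∈ D → U.a ≤ w.1 ∧ w.1 ≤ U.b ∧ z.1 - R ≤ w.1 ∧ w.1 ≤ z.1 + R ∧
      U.c ≤ w.2 ∧ w.2 ≤ U.d ∧ z.2 - R ≤ w.2 ∧ w.2 ≤ z.2 + R := by
    intro w hw
    have hwS := hDS hw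
    rw [SegExtLSetup.mem_Dbox_iff, SegExtLSetup.mem_Rbox_iff, mem_sqBox_iff'] at hw
    rw [SegExtLSetup.mem_S_iff] at hwS
    omega
  -- the port: the first entry of the far path into `D̄` (its last vertex `wfar` lies over `D`)
  have hwL : wfar ∈ Lfar := by
    have := hLfar.last_mem hLfar.ne_nil
    rw [Set.mem_singleton_iff] at this
    rw [← this]; exact List.getLast_mem _
  have hwfarD : planar k wfar ∈ D := by
    have hu1 : planar k wfar ∈ sqBox z 1 := planar_mem_sqBox_one_of_adj hwv.symm
    exact SegExtLSetup.mem_Dbox_iff.2 ⟨toRbox _ (hLfar.subset wfar hwL).1 (sqBox_mono _ (by omega) hu1),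
      sqBox_mono _ (by omega : 1 ≤ R) hu1⟩
  have hheadL : Lfar.head hLfar.ne_nil = c₀ := by
    have := hLfar.head_mem hLfar.ne_nil
    rwa [Set.mem_singleton_iff] at this
  have hheadD : planar k (Lfar.head hLfar.ne_nil) ∉ D := by rw [hheadL]; exact hc₀D
  obtain ⟨mfar, w', restfar, hmfar, hLeqfar, hmfarD, hw'D, hedgefar, -, -, hconnfar, -⟩ :=
    exists_entry (R := U.R) hLfar.chain hLfar.nodup (fun x hx => (hLfar.subset x hx).1) hLfar.ne_nil
      hheadD ⟨wfar, hwL, hwfarD⟩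
  rw [hheadL] at hconnfar
  set q₁ := mfar.getLast hmfar with hq₁def
  have hadj : (slabGraph 3 k).Adj w' q₁ := ((SimpleGraph.mem_edgeSet _).1 (hω hedgefar)).symm
  have hq₁D : planar k q₁ ∉ D := hmfarD _ (List.getLast_mem hmfar)
  have hσ : ω ∈ openConnIn (slabLift k (U.Q.R \ D)) q₁ c₀ := openConnIn_reverse hconnfar
  have hw'far : ¬Near k (U.Q.γ k ω) ρ (planar k w') := (hLfar.subset w' (by rw [hLeqfar]; simp)).2
  -- a vertex of `γ` over `D` other than the last
  obtain ⟨g₀, hg₀, hz⟩ := hnear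
  have hg₀z : planar k g₀ ∈ sqBox z ρ := GlueGeom.mem_sqBox_comm hz
  have hg₀h := ne_head_of_far_A (Q := U.Q) hA hz (by omega : ρ ≤ ρ + 3) hnA
  have hin : ∃ x ∈ U.Q.γ k ω, planar k x ∈ D ∧ x ≠ (U.Q.γ k ω).getLast hγO.ne_nil := by
    by_cases hlast : g₀ = (U.Q.γ k ω).getLast hγO.ne_nil
    · obtain ⟨u, huγ, hadj₀, -, hul⟩ := exists_pred hω hA hg₀ hg₀h
      refine ⟨u, huγ, SegExtLSetup.mem_Dbox_iff.2 ⟨U.S_subset_Rbox (hγO.subset u huγ),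
        sqBox_mono _ (by omega : ρ + 1 ≤ R) ?_⟩, hul⟩
      exact mem_sqBox_add hg₀z (planar_mem_sqBox_one_of_adj hadj₀.symm)
    · exact ⟨g₀, hg₀, SegExtLSetup.mem_Dbox_iff.2 ⟨U.S_subset_Rbox (hγO.subset g₀ hg₀),
        sqBox_mono _ (by omega) hg₀z⟩, hlast⟩
  -- the decomposition at the first vertex over `D`
  obtain ⟨p₀, E₁, rest, hγeq, hp₀, hrest, hp₀D, hE₁D⟩ := exists_decompB (Q := U.Q) hA hDA hin
  have hE₁γ : E₁ ∈ U.Q.γ k ω := by rw [hγeq]; simp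
  have hE₁B : planar k E₁ ∉ U.B := by
    intro hB'
    have hex : ∃ l, IsOSAP k ω (slabLift k U.Q.S) (slabLift k U.Q.A) (slabLift k U.Q.B) l :=
      (mem_slabConn_iff_exists_isOSAP ω _ _ _).1 hA
    have h := minPath_prefix_getLast_not_mem U.Q.S_finite hex (p := p₀ ++ [E₁]) (s := rest)
      (by rw [show minPath k ω _ _ _ = U.Q.γ k ω from rfl, hγeq]; simp) hrest (by simp)
    simp at h
    exact h hB'
  obtain ⟨ha1, ha2, ha3, ha4, ha5, ha6, ha7, ha8⟩ := memD _ hE₁D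
  obtain ⟨hw1, hw2, hw3, hw4, hw5, hw6, hw7, hw8⟩ := memD _ hw'D
  -- the target vertex `β`
  set yw : ℤ := (planar k w').2 with hywdef
  set yU : ℤ := min U.y₂ (z.2 + R) with hyUdef
  set yL : ℤ := max U.y₁ (z.2 - R) with hyLdef
  set yβ : ℤ := if yw = yU then yL else yU with hyβdef
  have hyβ : U.y₁ ≤ yβ ∧ yβ ≤ U.y₂ ∧ z.2 - R ≤ yβ ∧ yβ ≤ z.2 + R ∧ yβ ≠ yw := by
    rw [hyβdef]; split_ifs with h <;> omega
  obtain ⟨hyβ1, hyβ2, hyβ3, hyβ4, hyβw⟩ := hyβ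
  set hβ : ℕ := if ht E₁ = 0 then 1 else 0 with hhβdef
  have hhβk : hβ ≤ k := by rw [hhβdef]; split_ifs <;> omega
  have hhβne : hβ ≠ ht E₁ := by rw [hhβdef]; split_ifs with h <;> omega
  set β : slab 3 k := vtx k (U.b, yβ) hβ with hβdef
  set β' : slab 3 k := vtx k (U.b - 1, yβ) hβ with hβ'def
  have hβp : planar k β = (U.b, yβ) := planar_vtx _ _
  have hβ'p : planar k β' = (U.b - 1, yβ) := planar_vtx _ _
  have hβB : planar k β ∈ U.B := by rw [hβp, SegExtLSetup.mem_B_iff]; exact ⟨rfl, hyβ1, hyβ2⟩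
  have hβS : planar k β ∈ U.S := SegExtLSetup.B_subset_S hβB
  have hβD : planar k β ∈ D := by
    rw [hβp, SegExtLSetup.mem_Dbox_iff, SegExtLSetup.mem_Rbox_iff, mem_sqBox_iff']
    refine ⟨⟨?_, ?_, ?_, ?_⟩, ?_, ?_, ?_, ?_⟩ <;> dsimp only <;> omega
  have hβ'RP : planar k β' ∈ RP := by
    rw [hβ'p]; refine memRP _ ?_ ?_ ?_ ?_ ?_ ?_ ?_ ?_ <;> dsimp only <;> omega
  have hadjβ : (slabGraph 3 k).Adj β' β := by
    refine adj_of_planarAdj (by rw [hβdef, hβ'def, ht_vtx hhβk, ht_vtx hhβk]) ?_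
    rw [hβp, hβ'p]
    exact planarAdj_left (by simp) (by simp)
  -- the terminal `E₁'` of the route (one step inward if `E₁` lies over the column `x = b`)
  set e₁ := planar k E₁ with he₁def
  set E₁' : slab 3 k := if e₁.1 = U.b then vtx k (U.b - 1, e₁.2) (ht E₁) else E₁ with hE₁'def
  have hE₁'ht : ht E₁' = ht E₁ := by
    rw [hE₁'def]; split_ifs
    · exact ht_vtx (ht_le E₁) _
    · rfl
  have hE₁'p : planar k E₁' ∈ sqBox e₁ 1 ∧ planar k E₁' ∈ RP := by
    rw [hE₁'def]; split_ifs with h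
    · rw [planar_vtx]
      refine ⟨by rw [mem_sqBox_iff']; dsimp only; omega, ?_⟩
      refine memRP _ ?_ ?_ ?_ ?_ ?_ ?_ ?_ ?_ <;> dsimp only <;> omega
    · refine ⟨mem_sqBox_self _ _, ?_⟩
      rw [SegExtLSetup.mem_DG_iff]
      exact ⟨hγO.subset E₁ hE₁γ, (SegExtLSetup.mem_Dbox_iff.1 hE₁D).2, h⟩
  obtain ⟨hE₁'near, hE₁'RP⟩ := hE₁'p
  have hE₁'β' : E₁' ≠ β' := by
    intro h
    have := congrArg ht h
    rw [hE₁'ht, hβ'def, ht_vtx hhβk] at this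
    exact hhβne this.symm
  -- the terminal `w''` of the route (one step inward if `w'` lies over the column `x = b`)
  set ew := planar k w' with hewdef
  set w'' : slab 3 k := if ew.1 = U.b then vtx k (U.b - 1, ew.2) (ht w') else w' with hw''def
  have hw''p : planar k w'' ∈ sqBox ew 1 ∧ planar k w'' ∈ RP ∧ (planar k w'').2 = yw := by
    rw [hw''def]; split_ifs with h
    · rw [planar_vtx]
      refine ⟨by rw [mem_sqBox_iff']; dsimp only; omega, ?_, by simp [hywdef, hewdef]⟩
      refine memRP _ ?_ ?_ ?_ ?_ ?_ ?_ ?_ ?_ <;> dsimp only <;> omega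
    · refine ⟨mem_sqBox_self _ _, ?_, rfl⟩
      rw [SegExtLSetup.mem_DG_iff]
      exact ⟨hDS hw'D, (SegExtLSetup.mem_Dbox_iff.1 hw'D).2, h⟩
  obtain ⟨hw''near, hw''RP, hw''y⟩ := hw''p
  have hw''E₁' : planar k E₁' ≠ planar k w'' := by
    intro h
    -- then `planar w'` is within `2` of `e₁ ∈ γ̄`, contradicting `¬ Near ρ`
    apply hw'far
    refine Near.mono (by omega : 2 ≤ ρ) ⟨E₁, hE₁γ, ?_⟩
    have h1 : planar k w'' ∈ sqBox e₁ 1 := h ▸ hE₁'near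
    have h2 : ew ∈ sqBox (planar k w'') 1 := GlueGeom.mem_sqBox_comm hw''near
    exact mem_sqBox_add h1 h2
  have hw''β' : planar k β' ≠ planar k w'' := by
    intro h
    have := congrArg Prod.snd h
    rw [hβ'p, hw''y] at this
    exact hyβw (by simpa using this)
  -- the rows of the route box
  have hrows : max U.c (z.2 - (R : ℕ)) + 3 ≤ min U.d (z.2 + (R : ℕ)) := by
    simp only [max_add, le_min_iff, max_le_iff]
    omega
  -- the route in `RP`
  obtain ⟨L, Br, c, spec⟩ := exists_route (xL := max U.a (z.1 - (R : ℕ)))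
    (xR' := min (U.b - 1) (z.1 + (R : ℕ))) (xR := min (U.b - 1) (z.1 + (R : ℕ)))
    (rB := max U.c (z.2 - (R : ℕ))) (rP := min U.d (z.2 + (R : ℕ))) (rT := min U.d (z.2 + (R : ℕ)))
    hk (by omega) le_rfl hrows le_rfl hE₁'RP hβ'RP hw''RP hE₁'β'
    hw''E₁' hw''β'
  have hLRP : ∀ v ∈ L, planar k v ∈ RP := spec.hL_sub
  have hBrRP : ∀ v ∈ Br, planar k v ∈ RP := spec.hBr_sub
  have notRP_b : ∀ w : ℤ × ℤ, w.1 = U.b → w ∉ RP := fun w hw h => (SegExtLSetup.mem_DG_iff.1 h).2.2 hw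
  have hw'E₁ : w' ≠ E₁ := by
    intro h
    exact hw'far (Near.mono (Nat.zero_le _) ⟨E₁, hE₁γ, by rw [hewdef, h]; exact mem_sqBox_self _ 0⟩)
  -- step 1: the branch ends at `w'`
  obtain ⟨Br₁, spec₁, hBr₁⟩ : ∃ Br₁, RouteSpec k RP D E₁' β' w' L Br₁ c ∧
      ∀ v ∈ Br₁, planar k v ∈ RP ∨ v = w' := by
    by_cases h : ew.1 = U.b
    · have hw''eq : w'' = vtx k (U.b - 1, ew.2) (ht w') := by rw [hw''def, if_pos h]
      have hadjw : (slabGraph 3 k).Adj w'' w' := by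
        refine adj_of_planarAdj (by rw [hw''eq, ht_vtx (ht_le _)]) ?_
        rw [hw''eq, planar_vtx]
        exact planarAdj_left (by dsimp only; rw [← hewdef]; omega) rfl
      have hw'L : w' ∉ L := fun hm => notRP_b ew h (hLRP _ hm)
      have hw'CB : w' ∉ c :: Br := by
        intro hm
        rcases List.mem_cons.1 hm with hm | hm
        · exact notRP_b ew h (by rw [hewdef, hm]; exact hLRP _ spec.hc)
        · exact notRP_b ew h (hBrRP _ hm)
      refine ⟨Br ++ [w'], RouteSpec.concat_branch spec hRPD hadjw hw'L hw'CB hw'D, fun v hv => ?_⟩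
      rcases List.mem_append.1 hv with hv | hv
      · exact Or.inl (hBrRP v hv)
      · exact Or.inr (List.mem_singleton.1 hv)
    · have hw''eq : w'' = w' := by rw [hw''def, if_neg h]
      refine ⟨Br, ?_, fun v hv => Or.inl (hBrRP v hv)⟩
      rw [← hw''eq]; exact RouteSpec.mono spec subset_rfl hRPD
  -- step 2: the trunk starts at `E₁`
  obtain ⟨L₂, spec₂, hL₂⟩ : ∃ L₂, RouteSpec k D D E₁ β' w' L₂ Br₁ c ∧
      ∀ v ∈ L₂, v ≠ E₁ → planar k v ∈ RP := by
    by_cases h : e₁.1 = U.b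
    · have hE₁'eq : E₁' = vtx k (U.b - 1, e₁.2) (ht E₁) := by rw [hE₁'def, if_pos h]
      have hadjE : (slabGraph 3 k).Adj E₁ E₁' := by
        refine (adj_of_planarAdj (by rw [hE₁'eq, ht_vtx (ht_le _)]) ?_).symm
        rw [hE₁'eq, planar_vtx]
        exact planarAdj_left (by dsimp only; rw [← he₁def]; omega) rfl
      have hE₁L : E₁ ∉ L := fun hm => notRP_b e₁ h (hLRP _ hm)
      have hE₁Br : E₁ ∉ Br₁ := by
        intro hm
        rcases hBr₁ _ hm with h' | h'
        · exact notRP_b e₁ h h'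
        · exact hw'E₁ h'.symm
      refine ⟨E₁ :: L, RouteSpec.cons_trunk spec₁ hRPD hadjE hE₁L hE₁Br hE₁D, fun v hv hne => ?_⟩
      rcases List.mem_cons.1 hv with hv | hv
      · exact absurd hv hne
      · exact hLRP v hv
    · have hE₁'eq : E₁' = E₁ := by rw [hE₁'def, if_neg h]
      refine ⟨L, ?_, fun v hv _ => hLRP v hv⟩
      rw [← hE₁'eq]; exact RouteSpec.mono spec₁ hRPD subset_rfl
  -- step 3: the trunk ends at `β`
  have hβL₂ : β ∉ L₂ := by
    intro hm
    by_cases hβE : β = E₁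
    · exact hE₁B (by rw [he₁def, ← hβE]; exact hβB)
    · exact notRP_b _ (by rw [hβp]) (hL₂ β hm hβE)
  have hβBr₁ : β ∉ Br₁ := by
    intro hm
    rcases hBr₁ _ hm with h' | h'
    · exact notRP_b _ (by rw [hβp]) h'
    · apply hyβw
      have := congrArg (fun v => (planar k v).2) h'
      simp only [hβp] at this
      rw [this]
  have spec₃ : RouteSpec k D D E₁ β w' (L₂ ++ [β]) Br₁ c :=
    RouteSpec.concat_trunk spec₂ subset_rfl hadjβ hβL₂ hβBr₁ hβD
  have hint : ∀ v ∈ L₂ ++ [β], v ≠ E₁ → v ≠ β → planar k v ∈ U.Q.S ∧ planar k v ∉ U.Q.B := by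
    intro v hv hvE hvβ
    rcases List.mem_append.1 hv with hv | hv
    · have hvRP := hL₂ v hv hvE
      exact ⟨(SegExtLSetup.mem_DG_iff.1 hvRP).1, SegExtLSetup.DG_disjoint_B hvRP⟩
    · exact absurd (List.mem_singleton.1 hv) hvβ
  have hE₁β : E₁ ≠ β := fun h => hE₁B (by rw [he₁def, h]; exact hβB)
  obtain ⟨sb, hsb⟩ := exists_surgeryB_of_decomp (Q := U.Q) (SegExtLSetup.Dbox_subset_R _ _) hDA hγeq
    hp₀ hrest hp₀D hE₁D hE₁β hβD hβS hβB hadj hq₁D hc₀ hσ spec₃ hint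
  exact ⟨sb, hsb ▸ hDz⟩

end AtB

/-! ## The located-gadget supply and the high-probability GL -/

section Supply

variable {U : SegExtLSetup} {ω : BondConfig (slab 3 k)} {ρ : ℕ}

/-- **A located gadget at every entry cell inside `R`** (segment target `B` at least `2ρ + 6` below the
top row of `S`, `C` at sup-distance `> 2ρ + 3` from `S`, `dist*(A, C) > 4ρ + 8`): for a lattice
configuration of `𝒳_ρ` and `y ∈ U_ent(ω) ∩ R`, one of the three port-data constructors applies — a
direct gluing near `A` if a cell of `A` is within `ρ + 3`, else the `B`-near or the plain surgery
according to whether the cleared box meets `B`.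
[cite: NewmanTassionWu2017, §3.2 (proof of Theorem 3.7, Fact 2: "For any z ∈ U(ω) … we will construct ω^{(z)}")] -/
theorem exists_gadgetAt_segExtL (hk : 1 ≤ k) (hρ : 2 ≤ ρ) (hBtop : U.y₂ + 2 * ρ + 6 ≤ U.d)
    (hsep : ∀ a' ∈ U.A, ∀ c' ∈ U.C, c' ∉ sqBox a' (4 * ρ + 8))
    (hfarC : ∀ c' ∈ U.C, ∀ s' ∈ U.S, c' ∉ sqBox s' (2 * ρ + 3))
    (hRx : ∀ w ∈ U.Rx, ∀ s ∈ U.S, w ∉ sqBox s (2 * ρ + 4))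
    (hω : ω ⊆ (slabGraph 3 k).edgeSet) (hX : ω ∈ U.Q.evXn k ρ) {y : ℤ × ℤ} (hy : y ∈ U.Q.UentR k ρ ω) :
    ∃ ω', GadgetAt U.Q k (ρ + 3) ω ω' y := by
  have hX' : ω ∈ U.Q.evX k := hX.1
  have hA : ω ∈ U.Q.evAB k := hX'.1
  obtain ⟨⟨hnear, u, v, hvy, huv, hufar, c₀, hc₀, hj⟩, hyR⟩ := hy
  subst hvy
  obtain ⟨L, hL⟩ := exists_isOSAP_of_openConnIn hj
  have hvR : v ∈ slabLift k U.R := hyR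
  -- no cell of `C` near an entry cell
  have hnC : ∀ c' ∈ U.C, c' ∉ sqBox (planar k v) (ρ + 3) := by
    intro c' hc' hc'v
    obtain ⟨g, hg, hvg⟩ := hnear
    have hgS : planar k g ∈ U.S := (U.Q.γ_spec hA).1.subset g hg
    have : c' ∈ sqBox (planar k g) (ρ + (ρ + 3)) := mem_sqBox_add hvg hc'v
    exact hfarC c' hc' (planar k g) hgS (by rwa [show 2 * ρ + 3 = ρ + (ρ + 3) by ring])
  by_cases hA' : ∃ a' ∈ U.A, a' ∈ sqBox (planar k v) (ρ + 3)
  · obtain ⟨dg, hdg⟩ := exists_directGlue_A_segExtL_at hω hX' hsep hc₀ hL huv hnear hRx hA'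
    exact ⟨_, gadgetAt_of_directGlue_A (Q := U.Q) hX' dg hdg⟩
  push Not at hA'
  by_cases hB : U.Bnear (planar k v) (U.rad ρ (planar k v))
  · obtain ⟨sb, hsb⟩ := exists_surgeryB_segExtL_at hk hρ hω hX' hBtop hc₀ hL huv hvR hnear hA' hnC hRx hB
    exact ⟨_, gadgetAt_of_surgeryB (Q := U.Q) hX' sb hsb⟩
  · obtain ⟨sx, hsx⟩ := exists_surgery_segExtL_at hk hρ hω hX' hc₀ hL huv hvR hnear hA' hnC hRx hB
    exact ⟨_, gadgetAt_of_surgery (Q := U.Q) hX' sx hsx⟩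

/-- **NTW 2017, Theorem 3.7 (`S ⊊ R`), HIGH-PROBABILITY REGIME, segment target with a top extension —
unconditional.** For every `k ≥ 1`, `ρ ≥ 2`, `ε > 0`, `η > 0` there is `δ > 0` such that for every
`SegExtLSetup` `U` (`S = [a,b]×[c,d] ⊆ R = [a,b]×[c,d']`, `B = {b}×[y₁,y₂]` with `y₂ + 2ρ + 6 ≤ d`,
`A ⊆ S`, `C ⊆ R`) with `dist*(A, C) > 4ρ + 8` and `dist*(C, S) > 2ρ + 3`, and every `p ∈ [ε, 1-ε]`:
`P_p[C̄ ⟷^{R̄} 𝒩(Γ̄, ρ)] ≥ 1 - δ ⟹ P_p[C ⟷^R A] ≥ 1 - η` (`Γ = Γ_min^S(A, B)`).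
[cite: NewmanTassionWu2017, Theorem 3.7 (high-probability regime: h₁(1) = 1, uniformly)] -/
theorem glue_highProb_segExtL (k ρ : ℕ) (hk : 1 ≤ k) (hρ : 2 ≤ ρ) {ε : ℝ} (hε : 0 < ε) {η : ℝ}
    (hη : 0 < η) :
    ∃ δ : ℝ, 0 < δ ∧ ∀ (U : SegExtLSetup), U.y₂ + 2 * ρ + 6 ≤ U.d →
      (∀ a' ∈ U.A, ∀ c' ∈ U.C, c' ∉ sqBox a' (4 * ρ + 8)) →
      (∀ c' ∈ U.C, ∀ s' ∈ U.S, c' ∉ sqBox s' (2 * ρ + 3)) →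
      (∀ w ∈ U.Rx, ∀ s ∈ U.S, w ∉ sqBox s (2 * ρ + 4)) →
      ∀ (p : unitInterval), ε ≤ (p : ℝ) → (p : ℝ) ≤ 1 - ε →
      1 - δ ≤ (bondPercolation (slabGraph 3 k) p).real (U.Q.evNear k ρ) →
      1 - η ≤ (bondPercolation (slabGraph 3 k) p).real (U.Q.evCA k) := by
  obtain ⟨δ, hδ, H⟩ := glue_highProb_of_gadgets_entR k ρ (ρ + 3) hε hη
  refine ⟨δ, hδ, fun U hBtop hsep hfarC hRx p hpε hp1 hN => H U.Q (fun c' hc' s' hs' h => ?_) p hpε hp1 ?_ hN⟩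
  · exact hfarC c' hc' s' hs' (sqBox_mono _ (by omega) h)
  · intro ω hω hX y hy
    exact exists_gadgetAt_segExtL hk hρ hBtop hsep hfarC hRx hω hX hy

/-- **GL, LINEAR regime, segment target, locally-top-extension domain — unconditional.**
[cite: NewmanTassionWu2017, Theorem 3.7 with Remark 3 (h₀(x) ≥ c₀ x), Remark 2] -/
theorem glue_linear_segExtL (U : SegExtLSetup) (hk : 1 ≤ k) {ρ : ℕ} (hρ : 2 ≤ ρ)
    (hBtop : U.y₂ + 2 * ρ + 6 ≤ U.d)
    (hsep : ∀ a' ∈ U.A, ∀ c' ∈ U.C, c' ∉ sqBox a' (4 * ρ + 8))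
    (hfarC : ∀ c' ∈ U.C, ∀ s' ∈ U.S, c' ∉ sqBox s' (2 * ρ + 3))
    (hRx : ∀ w ∈ U.Rx, ∀ s ∈ U.S, w ∉ sqBox s (2 * ρ + 4))
    (p : unitInterval) (hp0 : 0 < (p : ℝ)) (hp1 : (p : ℝ) < 1) :
    (bondPercolation (slabGraph 3 k) p).real (U.Q.evAB k ∩ U.Q.evNear k ρ) ≤
      (1 + (2 / min (p : ℝ) (1 - p)) ^ (3 * ((5 * k + 4) * (2 * (2 * (ρ + 3)) + 1) ^ 2))) *
        (bondPercolation (slabGraph 3 k) p).real (U.Q.evCA k) :=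
  real_evAB_inter_evNear_le_of_gadgetsAt (Q := U.Q) (fun c' hc' s' hs' h => hfarC c' hc' s' hs' (sqBox_mono _ (by omega) h))
    (fun _ω hω hX _y hy => exists_gadgetAt_segExtL hk hρ hBtop hsep hfarC hRx hω hX hy) p hp0 hp1

end Supply

/-! ## The `Γ`-free forms -/

section GammaFree

/-- **The two-domain planar crossing, locally-top-extension domain**: in `S = [a,b]×[c,d]` and
`R = [a,b]×[c,d'] ∪ Rx` with no cell of `Rx` adjacent to `S`, every planar walk in `S` from the bottom row
to a right-side cell at height `≥ t` meets every planar walk in `R` from outside `S` to a right-side cell of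
`S` at height `≤ t < d` (the latter's final portion after its last vertex outside `S` starts on the top
row of `S`). [cite: NewmanTassionWu2017, Proposition 3.9 (proof, (3.29)); Remark 2] -/
theorem cross₂_of_segExtL {a b c d d' t : ℤ} (htd : t < d) {Rx : Set (ℤ × ℤ)}
    (hRx : ∀ w ∈ Rx, ∀ s ∈ boxR a b c d, w ∉ sqBox s 1) {A B C Dd : Set (ℤ × ℤ)}
    (hA : ∀ z ∈ A, z.2 = c) (hB : ∀ z ∈ B, z.1 = b ∧ t ≤ z.2) (hC : ∀ z ∈ C, z ∉ boxR a b c d)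
    (hD : ∀ z ∈ Dd, z.1 = b ∧ c ≤ z.2 ∧ z.2 ≤ t) :
    ∀ (l₁ l₂ : List (ℤ × ℤ)) (h₁ : l₁ ≠ []) (h₂ : l₂ ≠ []), IsPlanarWalk l₁ → IsPlanarWalk l₂ →
      (∀ z ∈ l₁, z ∈ boxR a b c d) → (∀ z ∈ l₂, z ∈ boxR a b c d' ∪ Rx) → l₁.head h₁ ∈ A → l₁.getLast h₁ ∈ B →
      l₂.head h₂ ∈ C → l₂.getLast h₂ ∈ Dd → ∃ z ∈ l₁, z ∈ l₂ := by
  intro l₁ l₂ h₁ h₂ hw₁ hw₂ hS₁ hS₂ hhA hlB hhC hlD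
  -- the last vertex `x` of `l₂` outside `S`
  have hrev : ∃ x ∈ l₂.reverse, x ∉ boxR a b c d :=
    ⟨l₂.head h₂, by simp [List.head_mem h₂], hC _ hhC⟩
  obtain ⟨m₁, x, m₂, hmeq, hxb, hm₁⟩ :=
    exists_first_split (p := fun z : ℤ × ℤ => z ∉ boxR a b c d) l₂.reverse hrev
  have hl₂eq : l₂ = m₂.reverse ++ x :: m₁.reverse := by
    have := congrArg List.reverse hmeq
    simpa using this
  have hm₁ne : m₁ ≠ [] := by
    intro hm
    subst hm
    have hlast : l₂.getLast h₂ = x := by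
      rw [List.getLast_congr _ (by simp) hl₂eq]; simp
    obtain ⟨h1, h2, h3⟩ := hD _ hlD
    rw [hlast] at h1 h2 h3
    apply hxb; rw [mem_boxR_iff]
    have hb : a ≤ b := by
      have := hS₁ _ (List.head_mem h₁); rw [mem_boxR_iff] at this; omega
    omega
  obtain ⟨y, ys, hys⟩ := List.exists_cons_of_ne_nil (show m₁.reverse ≠ [] by simpa using hm₁ne)
  rw [hys] at hl₂eq
  have hsufsub : ∀ z ∈ y :: ys, z ∈ l₂ := by
    intro z hz; rw [hl₂eq]; exact List.mem_append_right _ (List.mem_cons_of_mem _ hz)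
  have hsufS : ∀ z ∈ y :: ys, z ∈ boxR a b c d := by
    intro z hz
    have := hm₁ z (by rw [← List.mem_reverse, hys]; exact hz)
    simpa using this
  have hwxs : IsPlanarWalk (x :: y :: ys) := by
    have hw : IsPlanarWalk (m₂.reverse ++ x :: y :: ys) := by rw [← hl₂eq]; exact hw₂
    exact (List.isChain_append.1 hw).2.1
  have hwsuf : IsPlanarWalk (y :: ys) := (List.isChain_cons_cons.1 hwxs).2
  have hyS : y ∈ boxR a b c d := hsufS y (by simp)
  have hxR : x ∈ boxR a b c d' ∪ Rx := hS₂ x (by rw [hl₂eq]; simp)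
  have hyrow : y.2 = d := by
    have hstep : x = y ∨ planarAdj x y := (List.isChain_cons_cons.1 hwxs).1
    rcases hstep with rfl | h
    · exact absurd hyS hxb
    · rcases hxR with hxR | hxR
      · rw [mem_boxR_iff] at hxR hyS
        have hxS : ¬(a ≤ x.1 ∧ x.1 ≤ b ∧ c ≤ x.2 ∧ x.2 ≤ d) := by rwa [mem_boxR_iff] at hxb
        obtain ⟨x1, x2⟩ := x; obtain ⟨y1, y2⟩ := y
        simp only [planarAdj, Prod.mk_add_mk, Prod.mk.injEq, add_zero] at h
        simp only at hxR hyS hxS ⊢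
        omega
      · exfalso
        refine hRx x hxR y hyS ?_
        obtain ⟨x1, x2⟩ := x; obtain ⟨y1, y2⟩ := y
        simp only [planarAdj, Prod.mk_add_mk, Prod.mk.injEq, add_zero] at h
        rw [mem_sqBox_iff']
        simp only
        omega
  have hne : (y :: ys) ≠ [] := List.cons_ne_nil _ _
  have hhead' : ((y :: ys).head hne).2 = d := by simpa using hyrow
  have hlast' : (y :: ys).getLast hne ∈ Dd := by
    have e1 : l₂.getLast h₂ = (x :: y :: ys).getLast (by simp) := by
      rw [List.getLast_congr _ (by simp) hl₂eq, List.getLast_append_of_ne_nil _ (by simp)]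
    have e2 : (x :: y :: ys).getLast (by simp) = (y :: ys).getLast hne := by simp
    rw [← e2, ← e1]; exact hlD
  obtain ⟨z, hz₁, hz₂⟩ := planarCrossing_bottom_top_rightSegs (a := a) (b := b) (c := c) (d := d) (t := t)
    (A := A) (B := B) (C := {z | z.2 = d}) (D := Dd) hA hB (fun z hz => hz) (fun z hz => ⟨(hD z hz).1, (hD z hz).2.2⟩)
    l₁ (y :: ys) h₁ hne hw₁ hwsuf hS₁ hsufS hhA hlB hhead' hlast'
  exact ⟨z, hz₁, hsufsub z hz₂⟩

/-- **GL, high-probability regime, segment target, locally-top-extension domain, `Γ`-free form**: for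
every `k ≥ 1`, `ρ ≥ 2`, `ε > 0`, `η > 0` there is `δ > 0` such that for every `SegExtLSetup` `U` with
`y₂ + 2ρ + 6 ≤ d`, `A` on the bottom row of `S`, `D′` on the right side of `S` at heights in `[c, t]` with
`t < y₁`, `dist*(A,C) > 4ρ+8`, `dist*(C,S) > 2ρ+3`, `dist*(Rx,S) > 2ρ+4`, and every `p ∈ [ε,1-ε]`:
`P_p[A ⟷^S B] ≥ 1-δ` and `P_p[C ⟷^R D′] ≥ 1-δ` imply `P_p[C ⟷^R A] ≥ 1-η`.
[cite: NewmanTassionWu2017, Proposition 3.9 (proof, (3.29)) with Theorem 3.6/3.7 (high-probability regime), Remark 2] -/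
theorem glue0_highProb_segExtL (k ρ : ℕ) (hk : 1 ≤ k) (hρ : 2 ≤ ρ) {ε : ℝ} (hε : 0 < ε) {η : ℝ} (hη : 0 < η) :
    ∃ δ : ℝ, 0 < δ ∧ ∀ (U : SegExtLSetup) (Dd : Set (ℤ × ℤ)) (t : ℤ), U.y₂ + 2 * ρ + 6 ≤ U.d →
      (∀ z ∈ U.A, z.2 = U.c) → (∀ z ∈ Dd, z.1 = U.b ∧ U.c ≤ z.2 ∧ z.2 ≤ t) → t < U.y₁ →
      (∀ a' ∈ U.A, ∀ c' ∈ U.C, c' ∉ sqBox a' (4 * ρ + 8)) →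
      (∀ c' ∈ U.C, ∀ s' ∈ U.S, c' ∉ sqBox s' (2 * ρ + 3)) →
      (∀ w ∈ U.Rx, ∀ s ∈ U.S, w ∉ sqBox s (2 * ρ + 4)) →
      ∀ (p : unitInterval), ε ≤ (p : ℝ) → (p : ℝ) ≤ 1 - ε →
      1 - δ ≤ (bondPercolation (slabGraph 3 k) p).real (U.Q.evAB k) →
      1 - δ ≤ (bondPercolation (slabGraph 3 k) p).real (slabConn k U.R U.C Dd) →
      1 - η ≤ (bondPercolation (slabGraph 3 k) p).real (U.Q.evCA k) := by
  obtain ⟨δ, hδ, H⟩ := glue_highProb_segExtL k ρ hk hρ hε hη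
  refine ⟨δ / 2, by linarith, fun U Dd t hBtop hA hD ht hsep hfarC hRx p hpε hp1 hAB hCD => ?_⟩
  refine H U hBtop hsep hfarC hRx p hpε hp1 ?_
  have hy₁ := U.hy₁; have hy := U.hy; have hy₂ := U.hy₂
  have hcross := cross₂_of_segExtL (a := U.a) (b := U.b) (c := U.c) (d := U.d) (d' := U.d') (t := t)
    (Rx := U.Rx) (by omega) (fun w hw s hs h => hRx w hw s hs (sqBox_mono _ (by omega) h))
    (A := U.Q.A) (B := U.Q.B) (C := U.Q.C) (Dd := Dd) hA
    (fun z hz => ⟨(SegExtLSetup.mem_B_iff.1 hz).1, by have := (SegExtLSetup.mem_B_iff.1 hz).2.1; omega⟩)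
    (fun z hz hzS => hfarC z hz z hzS (mem_sqBox_self _ _)) hD
  have h := GlueData.real_evNear_ge_of_cross₂ (Q := U.Q) (k := k) (ρ := ρ) (Dd := Dd) hcross p
  have : (bondPercolation (slabGraph 3 k) p).real (slabConn k U.Q.R U.Q.C Dd) =
      (bondPercolation (slabGraph 3 k) p).real (slabConn k U.R U.C Dd) := rfl
  linarith

/-- **GL, linear regime, segment target, locally-top-extension domain, `Γ`-free product form**: under the
side conditions of `glue_linear_segExtL`, with `A` on the bottom row of `S` and `D′` on the right side of
`S` below `B`, for `0 < p < 1`: `P_p[A ⟷^S B] · P_p[C ⟷^R D′] ≤ (1 + λ_p^s) · P_p[C ⟷^R A]`.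
[cite: NewmanTassionWu2017, Theorem 3.6 with Remark 3, §3.4 ((3.65))] -/
theorem glue0_linear_segExtL (U : SegExtLSetup) (hk : 1 ≤ k) {ρ : ℕ} (hρ : 2 ≤ ρ)
    (hBtop : U.y₂ + 2 * ρ + 6 ≤ U.d) {Dd : Set (ℤ × ℤ)} {t : ℤ}
    (hA : ∀ z ∈ U.A, z.2 = U.c) (hD : ∀ z ∈ Dd, z.1 = U.b ∧ U.c ≤ z.2 ∧ z.2 ≤ t) (ht : t < U.y₁)
    (hsep : ∀ a' ∈ U.A, ∀ c' ∈ U.C, c' ∉ sqBox a' (4 * ρ + 8))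
    (hfarC : ∀ c' ∈ U.C, ∀ s' ∈ U.S, c' ∉ sqBox s' (2 * ρ + 3))
    (hRx : ∀ w ∈ U.Rx, ∀ s ∈ U.S, w ∉ sqBox s (2 * ρ + 4))
    (p : unitInterval) (hp0 : 0 < (p : ℝ)) (hp1 : (p : ℝ) < 1) :
    (bondPercolation (slabGraph 3 k) p).real (slabConn k U.S U.A U.B) *
        (bondPercolation (slabGraph 3 k) p).real (slabConn k U.R U.C Dd) ≤
      (1 + (2 / min (p : ℝ) (1 - p)) ^ (3 * ((5 * k + 4) * (2 * (2 * (ρ + 3)) + 1) ^ 2))) *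
        (bondPercolation (slabGraph 3 k) p).real (slabConn k U.R U.C U.A) := by
  set P := bondPercolation (slabGraph 3 k) p with hP
  have hlocS : IsLocalEvent (slabConn k U.S U.A U.B) := by
    refine ⟨(finite_sym2 (slabLift_finite k (boxR_finite U.a U.b U.c U.d))).toFinset, ?_⟩
    rw [Set.Finite.coe_toFinset]
    exact determinedBy_slabConn k _ _ subset_rfl
  have hlocR : IsLocalEvent (slabConn k U.R U.C Dd) := by
    refine ⟨(finite_sym2 (slabLift_finite k U.R_finite)).toFinset, ?_⟩
    rw [Set.Finite.coe_toFinset]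
    exact determinedBy_slabConn k _ _ subset_rfl
  have hH : P.real (slabConn k U.S U.A U.B) * P.real (slabConn k U.R U.C Dd) ≤
      P.real (slabConn k U.S U.A U.B ∩ slabConn k U.R U.C Dd) :=
    harris_fkg_local (slabGraph 3 k) p (isUpperSet_openCrossing _ _ _) (isUpperSet_openCrossing _ _ _)
      hlocS hlocR
  have hy₁ := U.hy₁; have hy := U.hy; have hy₂ := U.hy₂
  have hcross := cross₂_of_segExtL (a := U.a) (b := U.b) (c := U.c) (d := U.d) (d' := U.d') (t := t)
    (Rx := U.Rx) (by omega) (fun w hw s hs h => hRx w hw s hs (sqBox_mono _ (by omega) h))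
    (A := U.Q.A) (B := U.Q.B) (C := U.Q.C) (Dd := Dd) hA
    (fun z hz => ⟨(SegExtLSetup.mem_B_iff.1 hz).1, by have := (SegExtLSetup.mem_B_iff.1 hz).2.1; omega⟩)
    (fun z hz hzS => hfarC z hz z hzS (mem_sqBox_self _ _)) hD
  have hae : ∀ᵐ ω ∂P, ω ∈ slabConn k U.S U.A U.B ∩ slabConn k U.R U.C Dd →
      ω ∈ U.Q.evAB k ∩ U.Q.evNear k ρ := by
    filter_upwards [ae_subset_edgeSet (slabGraph 3 k) p] with ω hω
    rintro ⟨hAB, hCD⟩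
    exact ⟨hAB, GlueData.mem_evNear_of_cross₂ (Q := U.Q) hcross hω hAB hCD⟩
  have hmono : P.real (slabConn k U.S U.A U.B ∩ slabConn k U.R U.C Dd) ≤
      P.real (U.Q.evAB k ∩ U.Q.evNear k ρ) := by
    simp only [measureReal_def]
    exact ENNReal.toReal_mono (measure_ne_top _ _) (measure_mono_ae hae)
  exact hH.trans (hmono.trans (glue_linear_segExtL U hk hρ hBtop hsep hfarC hRx p hp0 hp1))

end GammaFree

end NTW17


end Literature.Probability.Percolation

end
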